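/- LEAD seat `ym-line-cbag-p1` (prover-ym-line-cbag-p1-g28-0), LINE 7 `GlueballBandRecursion`, item ⟨stmt-QuantumFields-22957⟩
`OneParticleBlochSymbolFamily`: clause (P3) machinery for the one-stub skeleton — the attained supremum of the Rayleigh quotients of a periodic
Hermitian symbol and its comparison with the band top through power sums and the log-C² bound.  Route-dependent only through the import of
`…BlochDoor` (Hermitian-matrix bookkeeping §1); a helper. -/
import Summits.QuantumFields.YangMills.Theorems.GlueballBandRecursionTransferSymbol
import Summits.QuantumFields.YangMills.Theorems.GlueballBandRecursionOneGlueballBandDichotomyBlochDoor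

/-!
# Route `GlueballBandRecursion`, item `OneParticleBlochSymbolFamily` (stmt-QuantumFields-22957): the supremum of the Rayleigh quotients of
# a periodic Hermitian symbol is attained and lies within `12π²K/N²` of the band top (clause (P3) machinery)

Setting of clause (P3) of `Band.EffectiveBlochSymbolFamily`: a `2π`-periodic Hermitian symbol `B̃ : ℝ³ → Herm_n(ℂ)` with positive
log-C² Rayleigh quotients `R_u(q) = Re⟪u, B̃(q)u⟫` ((P1), (P2) with constant `K`) whose lattice-angle power sums are the power sums of a finite
family of band ratios `w_k ≥ 0`: `Σ_p Re tr B̃(θ_p)^t = Σ_k w_k^t` (what `…BlochTransfer.transfer_bloch_reduction` + `…TransferSymbol`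
give for the symbol of a covariant frame).  This file proves:
* §1 `le_of_pow_le_mul_pow`: `a^t ≤ C·b^t` for all `t` forces `a ≤ b` (`a ≥ 0`, `b > 0`);
* §2 Hermitian bookkeeping on top of `…BlochDoor` §1: `Re tr A^t ≤ n·Λ^t` when the unit Rayleigh quotients lie in `[0, Λ]`
  (`re_trace_pow_le_of_rayleigh_le`), `R_u^{2t} ≤ Re tr A^{2t}` for `R_u ≥ 0` (`rayleigh_pow_le_re_trace_pow`), `0 ≤ Re tr A^{2t}`;
* §3 `exists_latticeAngle_near`: every `x ∈ ℝ³` is within `|v|² ≤ 12π²/N²` of a lattice angle up to `2πℤ³`;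
* §4 **`abs_log_sup_sub_log_bandTop_le`**: if `Λ = R_{us}(qs)` is the supremum of all unit Rayleigh quotients then
  `|log Λ − log max_k w_k| ≤ 12π²K/N²` — so the def's `|log Λ − ℓ| ≤ D'/N` follows from volume stability of the DISCRETE band top
  `|log max_k w_k − ℓ| ≤ D'/N` (an output of the cluster expansion) with `D' + 12π²K` in place of `D'`;
* §5 `exists_isMax_rayleigh_kernelSymbol`: for the symmetrised symbol of a torus kernel (`…TransferSymbol`, `n ≥ 1`) the supremum IS attained
  (continuity on the compact period cell × unit sphere, periodicity), producing the witnesses `(Λ, qs, us)` of clause (P3).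

HONEST FRAMING.  Conditional plumbing for the XL item 22957 (strong-coupling RECORD rung line); nothing about the item, the rung or the
Yang–Mills mass gap is proved here.
-/

set_option autoImplicit false

noncomputable section

open scoped InnerProductSpace BigOperators
open Finset Filter
open Literature.MathematicalPhysics.QuantumFieldTheory

namespace Summit.QuantumFields.YangMills.Theorems.GlueballBandRecursion.Band

/-! ### §1 A limit lemma -/

/-- If `a^t ≤ C·b^t` for every `t` (`b > 0`) then `a ≤ b` — otherwise `(a/b)^t → ∞`. [folklore] -/
theorem le_of_pow_le_mul_pow {a b C : ℝ} (hb : 0 < b) (h : ∀ t : ℕ, a ^ t ≤ C * b ^ t) : a ≤ b := by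
  by_contra hab
  have hab : b < a := lt_of_not_ge hab
  have hr : 1 < a / b := (one_lt_div hb).2 hab
  have hbound : ∀ t : ℕ, (a / b) ^ t ≤ C := fun t => by
    rw [div_pow, div_le_iff₀ (pow_pos hb t)]
    exact h t
  have htend := tendsto_pow_atTop_atTop_of_one_lt hr
  obtain ⟨t, ht⟩ := (htend.eventually (eventually_gt_atTop C)).exists
  exact absurd (hbound t) (not_le.2 ht)

/-! ### §2 Hermitian bookkeeping: traces of powers against Rayleigh bounds -/

section Hermitian

variable {n : ℕ}

/-- If every unit Rayleigh quotient of the Hermitian `A` lies in `[0, Λ]` then `Re tr A^t ≤ n·Λ^t` (the eigenvalues are Rayleigh quotients of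
unit eigenvectors). [folklore] -/
theorem re_trace_pow_le_of_rayleigh_le {A : Matrix (Fin n) (Fin n) ℂ} (hA : A.IsHermitian) {Λ : ℝ}
    (h0 : ∀ u : EuclideanSpace ℂ (Fin n), ‖u‖ = 1 → 0 ≤ RCLike.re ⟪u, Matrix.toEuclideanLin A u⟫_ℂ)
    (hΛ : ∀ u : EuclideanSpace ℂ (Fin n), ‖u‖ = 1 → RCLike.re ⟪u, Matrix.toEuclideanLin A u⟫_ℂ ≤ Λ) (t : ℕ) :
    ((A ^ t).trace).re ≤ n * Λ ^ t := by
  rw [re_trace_pow_eq_sum_eigenvalues_pow hA t]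
  have hev : ∀ i, 0 ≤ hA.eigenvalues i ∧ hA.eigenvalues i ≤ Λ := fun i => by
    have hu : ‖hA.eigenvectorBasis i‖ = 1 := hA.eigenvectorBasis.orthonormal.1 i
    rw [← re_inner_toEuclideanLin_eigenvectorBasis hA i]
    exact ⟨h0 _ hu, hΛ _ hu⟩
  calc ∑ i, hA.eigenvalues i ^ t ≤ ∑ _i : Fin n, Λ ^ t :=
        Finset.sum_le_sum fun i _ => pow_le_pow_left₀ (hev i).1 (hev i).2 t
    _ = n * Λ ^ t := by rw [Finset.sum_const, Finset.card_univ, Fintype.card_fin, nsmul_eq_mul]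

/-- `Re tr A^{2t} ≥ 0` for Hermitian `A`. [folklore] -/
theorem re_trace_pow_two_mul_nonneg {A : Matrix (Fin n) (Fin n) ℂ} (hA : A.IsHermitian) (t : ℕ) :
    0 ≤ ((A ^ (2 * t)).trace).re := by
  rw [re_trace_pow_eq_sum_eigenvalues_pow hA]
  exact Finset.sum_nonneg fun i _ => by rw [pow_mul]; exact pow_nonneg (sq_nonneg _) t

/-- A non-negative unit Rayleigh quotient is dominated in even powers by the trace: `R_u^{2t} ≤ Re tr A^{2t}` (`R_u ≤ λ_max`, whose even power
is one term of `Σ_i λ_i^{2t}`). [folklore] -/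
theorem rayleigh_pow_le_re_trace_pow {A : Matrix (Fin n) (Fin n) ℂ} (hA : A.IsHermitian) (u : EuclideanSpace ℂ (Fin n))
    (hu : ‖u‖ = 1) (h0 : 0 ≤ RCLike.re ⟪u, Matrix.toEuclideanLin A u⟫_ℂ) (t : ℕ) :
    (RCLike.re ⟪u, Matrix.toEuclideanLin A u⟫_ℂ) ^ (2 * t) ≤ ((A ^ (2 * t)).trace).re := by
  have hn : (Finset.univ : Finset (Fin n)).Nonempty := by
    rw [Finset.univ_nonempty_iff]
    by_contra h
    rw [not_nonempty_iff] at h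
    haveI := h
    have : u = 0 := Subsingleton.elim u 0
    rw [this, norm_zero] at hu
    exact zero_ne_one hu
  obtain ⟨j, -, hj⟩ := Finset.exists_max_image Finset.univ hA.eigenvalues hn
  have hR : RCLike.re ⟪u, Matrix.toEuclideanLin A u⟫_ℂ ≤ hA.eigenvalues j := by
    have h := re_inner_toEuclideanLin_le hA u (M := hA.eigenvalues j) fun i => hj i (Finset.mem_univ i)
    rwa [hu, one_pow, mul_one] at h
  rw [re_trace_pow_eq_sum_eigenvalues_pow hA]
  calc (RCLike.re ⟪u, Matrix.toEuclideanLin A u⟫_ℂ) ^ (2 * t) ≤ hA.eigenvalues j ^ (2 * t) := pow_le_pow_left₀ h0 hR _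
    _ ≤ ∑ i, hA.eigenvalues i ^ (2 * t) :=
        Finset.single_le_sum (f := fun i => hA.eigenvalues i ^ (2 * t)) (fun i _ => (even_two_mul t).pow_nonneg _)
          (Finset.mem_univ j)

end Hermitian

/-! ### §3 Every momentum is near a lattice angle modulo `2πℤ³` -/

variable {N : ℕ} [NeZero N]

/-- The coordinates of `siteToCube z` have the values of `z`. -/
theorem coordsF_siteToCube_val (z : Site 3 N) (i : Fin 3) : (coordsF (siteToCube z) i).val = (z i).val := by
  fin_cases i <;> rfl

/-- **Rounding to the lattice**: for every `x ∈ ℝ³` there are a lattice momentum `p`, an integer vector `m` and a correction `v` with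
`θ_p + 2πm = x + v` coordinatewise and `|v|² ≤ 12π²/N²` (`v_i ∈ (−2π/N, 0]`: round `x_i N/2π` down). -/
theorem exists_latticeAngle_near (x : Fin 3 → ℝ) :
    ∃ (p : Fin N × Fin N × Fin N) (m : Fin 3 → ℤ) (v : Fin 3 → ℝ),
      (∀ i, latticeAngle N p i + 2 * Real.pi * m i = x i + v i) ∧ ∑ i, v i ^ 2 ≤ 12 * Real.pi ^ 2 / (N : ℝ) ^ 2 := by
  have hN : (0 : ℝ) < N := by exact_mod_cast Nat.pos_of_ne_zero (NeZero.ne N)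
  have hπ : 0 < Real.pi := Real.pi_pos
  set c : ℝ := 2 * Real.pi / N with hc
  have hc0 : 0 < c := by positivity
  -- round down: `k_i = ⌊x_i / c⌋`, `p_i = k_i mod N`, `m_i = k_i div N`
  set k : Fin 3 → ℤ := fun i => ⌊x i / c⌋ with hk
  set z : Site 3 N := fun i => ((k i : ℤ) : ZMod N) with hz
  refine ⟨siteToCube z, fun i => k i / N, fun i => c * (k i : ℝ) - x i, fun i => ?_, ?_⟩
  · -- `θ_p(i) = c·(k_i mod N)`
    have hval : ((coordsF (siteToCube z) i).val : ℝ) = ((k i % N : ℤ) : ℝ) := by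
      rw [coordsF_siteToCube_val]
      have h := ZMod.val_intCast (n := N) (k i)
      simp only [hz] at h ⊢
      exact_mod_cast h
    have hdiv : ((k i % N : ℤ) : ℝ) = (k i : ℝ) - (N : ℝ) * ((k i / N : ℤ) : ℝ) := by
      have := Int.emod_def (k i) N
      rw [this]
      push_cast
      ring
    rw [latticeAngle, hval, hdiv]
    rw [hc]
    field_simp
    ring
  · -- `|v_i| ≤ c`
    have hv : ∀ i, (c * (k i : ℝ) - x i) ^ 2 ≤ c ^ 2 := by
      intro i
      have h1 : (k i : ℝ) ≤ x i / c := Int.floor_le _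
      have h2 : x i / c < (k i : ℝ) + 1 := Int.lt_floor_add_one _
      have h3 : c * (k i : ℝ) ≤ x i := by rwa [le_div_iff₀ hc0, mul_comm] at h1
      have h4 : x i < c * (k i : ℝ) + c := by
        rw [div_lt_iff₀ hc0] at h2
        linarith
      exact sq_le_sq' (by linarith) (by linarith)
    calc ∑ i, (c * (k i : ℝ) - x i) ^ 2 ≤ ∑ _i : Fin 3, c ^ 2 := Finset.sum_le_sum fun i _ => hv i
      _ = 3 * c ^ 2 := by rw [Finset.sum_const, Finset.card_univ, Fintype.card_fin, nsmul_eq_mul, Nat.cast_ofNat]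
      _ = 12 * Real.pi ^ 2 / (N : ℝ) ^ 2 := by rw [hc]; field_simp; ring

/-! ### §4 The supremum of the Rayleigh quotients against the band top -/

/-- **`|log Λ − log w_max| ≤ 12π²K/N²`.**  Let `B̃` be `2π`-periodic and Hermitian with positive unit Rayleigh quotients
`R_u(q) = Re⟪u, B̃(q)u⟫` obeying the log-C² bound with constant `K`, whose lattice-angle power sums are those of the non-negative
weights `w_k` with maximum `w_max > 0` (`Σ_p Re tr B̃(θ_p)^t = Σ_k w_k^t` for all `t`); let `Λ = R_{us}(qs)` dominate every unit Rayleigh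
quotient.  Then `log w_max ≤ log Λ ≤ log w_max + 12π²K/N²`.  [`w_max^{2t} ≤ Σ_k w_k^{2t} = Σ_p Re tr B̃(θ_p)^{2t} ≤ N³n Λ^{2t}`; and with
`θ_p + 2πm = qs + v`, `|v|² ≤ 12π²/N²`: `log R_{us}(θ_p) ≥ 2 log Λ − K|v|² − log R_{us}(qs − v) ≥ log Λ − K|v|²` while
`R_{us}(θ_p)^{2t} ≤ Σ_p Re tr B̃(θ_p)^{2t} = Σ_k w_k^{2t} ≤ |ι|·w_max^{2t}`.] -/
theorem abs_log_sup_sub_log_bandTop_le {n : ℕ} (Bt : (Fin 3 → ℝ) → Matrix (Fin n) (Fin n) ℂ)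
    (hH : ∀ q, (Bt q).IsHermitian)
    (hper : ∀ (q : Fin 3 → ℝ) (z : Fin 3 → ℤ), Bt (fun i => q i + 2 * Real.pi * z i) = Bt q)
    {ι : Type*} [Fintype ι] (w : ι → ℝ) (hw0 : ∀ k, 0 ≤ w k) (kt : ι) (hkt : ∀ k, w k ≤ w kt) (hpos : 0 < w kt)
    (hsum : ∀ t : ℕ, ∑ p : Fin N × Fin N × Fin N, ((Bt (latticeAngle N p) ^ t).trace).re = ∑ k, w k ^ t)
    (hP1 : ∀ u : EuclideanSpace ℂ (Fin n), ‖u‖ = 1 → ∀ q, 0 < RCLike.re ⟪u, Matrix.toEuclideanLin (Bt q) u⟫_ℂ)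
    {K : ℝ} (hK : 0 ≤ K)
    (hP2 : ∀ u : EuclideanSpace ℂ (Fin n), ‖u‖ = 1 → ∀ x v : Fin 3 → ℝ,
      2 * Real.log (RCLike.re ⟪u, Matrix.toEuclideanLin (Bt x) u⟫_ℂ) - K * ∑ i, v i ^ 2 ≤
        Real.log (RCLike.re ⟪u, Matrix.toEuclideanLin (Bt (x + v)) u⟫_ℂ) +
          Real.log (RCLike.re ⟪u, Matrix.toEuclideanLin (Bt (x - v)) u⟫_ℂ))
    {Λ : ℝ} {qs : Fin 3 → ℝ} {us : EuclideanSpace ℂ (Fin n)} (hus : ‖us‖ = 1)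
    (hat : RCLike.re ⟪us, Matrix.toEuclideanLin (Bt qs) us⟫_ℂ = Λ)
    (hle : ∀ (q : Fin 3 → ℝ) (u : EuclideanSpace ℂ (Fin n)), ‖u‖ = 1 →
      RCLike.re ⟪u, Matrix.toEuclideanLin (Bt q) u⟫_ℂ ≤ Λ) :
    Real.log (w kt) ≤ Real.log Λ ∧ Real.log Λ ≤ Real.log (w kt) + 12 * Real.pi ^ 2 * K / (N : ℝ) ^ 2 := by
  have hΛpos : 0 < Λ := by rw [← hat]; exact hP1 us hus qs
  have hN : (0 : ℝ) < N := by exact_mod_cast Nat.pos_of_ne_zero (NeZero.ne N)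
  -- unit Rayleigh quotients of each `Bt q` lie in `[0, Λ]`
  have h0 : ∀ q (u : EuclideanSpace ℂ (Fin n)), ‖u‖ = 1 → 0 ≤ RCLike.re ⟪u, Matrix.toEuclideanLin (Bt q) u⟫_ℂ :=
    fun q u hu => (hP1 u hu q).le
  -- (a) `w_max ≤ Λ`
  have ha : w kt ≤ Λ := by
    refine le_of_pow_le_mul_pow (C := (Fintype.card (Fin N × Fin N × Fin N) : ℝ) * n) hΛpos fun t => ?_
    -- it suffices for even exponents; reduce `t` to `2t` via squares?  We prove it for all `t` directly using `[0, Λ]`.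
    calc w kt ^ t ≤ ∑ k, w k ^ t := Finset.single_le_sum (fun k _ => pow_nonneg (hw0 k) t) (Finset.mem_univ kt)
      _ = ∑ p : Fin N × Fin N × Fin N, ((Bt (latticeAngle N p) ^ t).trace).re := (hsum t).symm
      _ ≤ ∑ _p : Fin N × Fin N × Fin N, (n : ℝ) * Λ ^ t :=
          Finset.sum_le_sum fun p _ => re_trace_pow_le_of_rayleigh_le (hH _) (h0 _) (fun u hu => hle _ u hu) t
      _ = (Fintype.card (Fin N × Fin N × Fin N) : ℝ) * n * Λ ^ t := by
          rw [Finset.sum_const, Finset.card_univ, nsmul_eq_mul, mul_assoc]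
  -- (b) a lattice angle near `qs`
  obtain ⟨p, m, v, hpm, hv⟩ := exists_latticeAngle_near (N := N) qs
  have hshift : Bt (latticeAngle N p) = Bt (qs + v) := by
    rw [← hper (latticeAngle N p) m]
    congr 1
    funext i
    rw [hpm i, Pi.add_apply]
  set Rp : ℝ := RCLike.re ⟪us, Matrix.toEuclideanLin (Bt (latticeAngle N p)) us⟫_ℂ with hRp
  have hRp_pos : 0 < Rp := hP1 us hus _
  -- the log-C² bound at `qs` in direction `v`
  have hlow : Real.log Λ - K * (12 * Real.pi ^ 2 / (N : ℝ) ^ 2) ≤ Real.log Rp := by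
    have h2 := hP2 us hus qs v
    rw [hat, ← hshift] at h2
    have h3 : Real.log (RCLike.re ⟪us, Matrix.toEuclideanLin (Bt (qs - v)) us⟫_ℂ) ≤ Real.log Λ :=
      Real.log_le_log (hP1 us hus _) (hle _ us hus)
    have h4 : K * ∑ i, v i ^ 2 ≤ K * (12 * Real.pi ^ 2 / (N : ℝ) ^ 2) := mul_le_mul_of_nonneg_left hv hK
    linarith
  -- `Rp ≤ w_max` by even power sums
  have hb : Rp ≤ w kt := by
    refine le_of_pow_le_mul_pow (C := (Fintype.card ι : ℝ)) hpos fun t => ?_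
    -- compare `Rp^t`: use `Rp^(2s)` bounds for even and reduce odd `t` by monotonicity?  Direct route: `Rp ≤ w kt` iff for all `t`,
    -- `Rp^(2t) ≤ |ι| (w kt)^(2t)`; we show the required bound for every `t` from the `2t` one and `Rp, w kt ≥ 0`.
    have heven : ∀ s : ℕ, Rp ^ (2 * s) ≤ (Fintype.card ι : ℝ) * w kt ^ (2 * s) := by
      intro s
      calc Rp ^ (2 * s) ≤ ((Bt (latticeAngle N p) ^ (2 * s)).trace).re :=
            rayleigh_pow_le_re_trace_pow (hH _) us hus hRp_pos.le s
        _ ≤ ∑ p' : Fin N × Fin N × Fin N, ((Bt (latticeAngle N p') ^ (2 * s)).trace).re :=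
            Finset.single_le_sum (fun p' _ => re_trace_pow_two_mul_nonneg (hH _) s) (Finset.mem_univ p)
        _ = ∑ k, w k ^ (2 * s) := hsum (2 * s)
        _ ≤ ∑ _k : ι, w kt ^ (2 * s) := Finset.sum_le_sum fun k _ => pow_le_pow_left₀ (hw0 k) (hkt k) _
        _ = (Fintype.card ι : ℝ) * w kt ^ (2 * s) := by rw [Finset.sum_const, Finset.card_univ, nsmul_eq_mul]
    -- from `Rp^(2t) ≤ C (w kt)^(2t)` get `Rp^t ≤ C' (w kt)^t` with `C' = max C 1 · ...`: simpler, apply the lemma to squares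
    have hsq : Rp ^ 2 ≤ w kt ^ 2 := by
      refine le_of_pow_le_mul_pow (C := (Fintype.card ι : ℝ)) (pow_pos hpos 2) fun s => ?_
      rw [← pow_mul, ← pow_mul]
      exact heven s
    have hRw : Rp ≤ w kt := by
      nlinarith [hRp_pos, hpos, hsq]
    have hC : (1 : ℝ) ≤ Fintype.card ι := by
      have : 0 < Fintype.card ι := Fintype.card_pos_iff.2 ⟨kt⟩
      exact_mod_cast this
    calc Rp ^ t ≤ w kt ^ t := pow_le_pow_left₀ hRp_pos.le hRw t
      _ ≤ (Fintype.card ι : ℝ) * w kt ^ t := le_mul_of_one_le_left (pow_nonneg hpos.le t) hC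
  constructor
  · exact Real.log_le_log hpos ha
  · have h1 : Real.log Rp ≤ Real.log (w kt) := Real.log_le_log hRp_pos hb
    have h2 : K * (12 * Real.pi ^ 2 / (N : ℝ) ^ 2) = 12 * Real.pi ^ 2 * K / (N : ℝ) ^ 2 := by ring
    linarith

/-! ### §5 The supremum of the Rayleigh quotients of the symmetrised torus symbol is attained -/

/-- **Clause (P3) witnesses for the symmetrised symbol of a torus kernel** (`n ≥ 1`): there are `qs ∈ ℝ³` and a unit `us` whose Rayleigh
quotient dominates all unit Rayleigh quotients of `B̃_J = kernelSymbol J` (continuity on the compact period cell × unit sphere, periodicity). -/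
theorem exists_isMax_rayleigh_kernelSymbol {n : ℕ} (hn : 0 < n) (J : Site 3 N → Matrix (Fin n) (Fin n) ℝ) :
    ∃ (qs : Fin 3 → ℝ) (us : EuclideanSpace ℂ (Fin n)), ‖us‖ = 1 ∧
      ∀ (q : Fin 3 → ℝ) (u : EuclideanSpace ℂ (Fin n)), ‖u‖ = 1 →
        RCLike.re ⟪u, Matrix.toEuclideanLin (kernelSymbol J q) u⟫_ℂ ≤
          RCLike.re ⟪us, Matrix.toEuclideanLin (kernelSymbol J qs) us⟫_ℂ := by
  set S : Set ((Fin 3 → ℝ) × EuclideanSpace ℂ (Fin n)) :=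
    (Set.univ.pi fun _ : Fin 3 => Set.Icc (0 : ℝ) (2 * Real.pi)) ×ˢ Metric.sphere (0 : EuclideanSpace ℂ (Fin n)) 1 with hS
  have hSc : IsCompact S := (isCompact_univ_pi fun _ => isCompact_Icc).prod (isCompact_sphere 0 1)
  -- a unit vector exists
  set u0 : EuclideanSpace ℂ (Fin n) := EuclideanSpace.basisFun (Fin n) ℂ ⟨0, hn⟩ with hu0
  have hu0n : ‖u0‖ = 1 := (EuclideanSpace.basisFun (Fin n) ℂ).orthonormal.1 ⟨0, hn⟩
  have hSne : S.Nonempty := ⟨(fun _ => 0, u0), by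
    refine ⟨Set.mem_univ_pi.2 fun _ => ⟨le_rfl, by positivity⟩, ?_⟩
    rw [mem_sphere_zero_iff_norm, hu0n]⟩
  obtain ⟨x, hxS, hmax⟩ := hSc.exists_isMaxOn hSne (continuous_rayleigh_kernelSymbol J).continuousOn
  have hxu : ‖x.2‖ = 1 := by
    have := (Set.mem_prod.1 hxS).2
    rwa [mem_sphere_zero_iff_norm] at this
  refine ⟨x.1, x.2, hxu, fun q u hu => ?_⟩
  -- reduce `q` into the period cell
  set q' : Fin 3 → ℝ := fun i => q i + 2 * Real.pi * ((-⌊q i / (2 * Real.pi)⌋ : ℤ) : ℝ) with hq'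
  have hper : kernelSymbol J q' = kernelSymbol J q := by
    have h := kernelSymbol_periodic J q (fun i => -⌊q i / (2 * Real.pi)⌋)
    rw [← h]
  have hq'mem : q' ∈ Set.univ.pi fun _ : Fin 3 => Set.Icc (0 : ℝ) (2 * Real.pi) := by
    refine Set.mem_univ_pi.2 fun i => ?_
    have hπ : 0 < 2 * Real.pi := by positivity
    have h1 : (⌊q i / (2 * Real.pi)⌋ : ℝ) ≤ q i / (2 * Real.pi) := Int.floor_le _
    have h2 : q i / (2 * Real.pi) < (⌊q i / (2 * Real.pi)⌋ : ℝ) + 1 := Int.lt_floor_add_one _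
    rw [le_div_iff₀ hπ] at h1
    rw [div_lt_iff₀ hπ] at h2
    simp only [hq', Int.cast_neg, Set.mem_Icc]
    constructor <;> nlinarith
  have hmem : (q', u) ∈ S := Set.mem_prod.2 ⟨hq'mem, by rw [mem_sphere_zero_iff_norm, hu]⟩
  have h := (isMaxOn_iff.mp hmax) (q', u) hmem
  simp only [hper] at h
  exact h

end Summit.QuantumFields.YangMills.Theorems.GlueballBandRecursion.Band

end
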